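import Summits.Parity.GeneralizedHardyLittlewood.Theorems.LiouvilleShiftedTablesSieveToMAvgConsts

/-!
# Sieve glue for `SieveToMAvg`, part 12f: the three majorants are small for large heights

Support file for item stmt-Parity-14274 (route `LiouvilleShiftedTables`).  With the LITERAL exponents
`e = 8192`, `A₁ = 8210` (slicing `Δ = (log Y)^{−8210}`), `C₄ = 16421` (Type-II saving `C = 4C₄`),
`A₂ = 20536` (Type-I₂ saving `A = 2A₂`), thresholds `a' = 2δ`, `b' = 1/3 + δ/2` and level `Q ≤ Y^{δ/4}`
(`0 < δ ≤ 1/12`), for all large `Y`, all `1 ≤ Q ≤ Y^{δ/4}`, all scales `x ∈ [Y/(2(log Y)^{13}), Y/2]`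
and `j ∈ {1,2,3}`:

  `BII ≤ Y/(log Y)^{16}`,  `BI2 ≤ Y/(log Y)^{16}`,  `SLIV ≤ Y/(log Y)^{10}`.
-/

namespace Summit.Parity.GeneralizedHardyLittlewood.Theorems.SieveToMAvg

open Finset Real Filter
open scoped ArithmeticFunction.zeta ArithmeticFunction.sigma ArithmeticFunction.vonMangoldt
open Literature.NumberTheory.Sieve.BVMoebius (eventually_log_rpow_le_rpow')

section Sizes

variable {δ : ℝ}

/-- `BII ≤ Y/(log Y)^{16}` for large `Y`. [folklore] -/
theorem BII_small_eventually (hδ : 0 < δ) (hδ12 : δ ≤ 1 / 12) {Cτ : ℝ} (hCτ : 1 ≤ Cτ) :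
    ∀ᶠ Y : ℝ in atTop, ∀ Q : ℕ, 1 ≤ Q → (Q : ℝ) ≤ Y ^ (δ / 4) →
      ∀ x : ℝ, Y / (2 * Real.log Y ^ 13) ≤ x → 2 * x ≤ Y → ∀ j ∈ Icc 1 3,
        BII j x Y (((4 * 16421 : ℕ) : ℝ)) Cτ 8192 (Kff 8210 Y) Q ≤ Y / Real.log Y ^ 16 := by
  have hlog : Tendsto (fun Y : ℝ => Real.log Y) atTop atTop := Real.tendsto_log_atTop
  obtain ⟨E, hE⟩ : ∃ E : ℝ, (2 : ℝ) ^ 8192 = E := ⟨_, rfl⟩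
  have hE0 : 0 < E := by rw [← hE]; positivity
  obtain ⟨K₁, hK₁⟩ : ∃ K : ℝ, 48 * E * Cτ = K := ⟨_, rfl⟩
  have hCτ0 : 0 ≤ Cτ := by linarith
  have hK₁0 : 0 ≤ K₁ := by rw [← hK₁]; positivity
  filter_upwards [hlog.eventually_ge_atTop (4 + Real.log 64 + K₁),
    ((tendsto_pow_atTop (by norm_num : (8210 : ℕ) ≠ 0)).comp hlog).eventually_ge_atTop 2,
    tendsto_lowScale.eventually_ge_atTop 1, Filter.eventually_gt_atTop (1 : ℝ)] with Y hL hLA hlo hY1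
    Q hQ1 hQ x hx hxY j hj
  obtain ⟨hj1, hj3⟩ := Finset.mem_Icc.1 hj
  set L := Real.log Y with hLdef
  have hl64 : 0 < Real.log 64 := Real.log_pos (by norm_num)
  have hL0 : 0 < L := by linarith
  have hLp : ∀ n : ℕ, 0 < L ^ n := fun n => pow_pos hL0 n
  have hY1' : 1 ≤ Y := hY1.le
  have hx1 : 1 ≤ x := le_trans hlo hx
  have hQY : (Q : ℝ) ≤ Y := hQ.trans (by
    calc Y ^ (δ / 4) ≤ Y ^ (1 : ℝ) := Real.rpow_le_rpow_of_exponent_le hY1' (by linarith)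
      _ = Y := Real.rpow_one Y)
  have hB := BII_le (e := 8192) (C₄ := 16421) (A₁ := 8210) hj3 hx1 hxY (by linarith) (by simpa using hLA) hQ1 hQY hCτ0
    (by norm_num)
  have e17 : (16421 : ℕ) - (8210 + 8192 + 2) = 17 := by norm_num
  rw [e17, hE, hK₁] at hB
  refine hB.trans ?_
  rw [div_le_div_iff₀ (hLp 17) (hLp 16)]
  calc K₁ * Y * L ^ 16 ≤ L * Y * L ^ 16 := by gcongr; linarith
    _ = Y * L ^ 17 := by ring

/-- `BI2 ≤ Y/(log Y)^{16}` for large `Y`. [folklore] -/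
theorem BI2_small_eventually (hδ : 0 < δ) (hδ12 : δ ≤ 1 / 12) {Cτ C' C₂ : ℝ} (hCτ : 1 ≤ Cτ) (hC' : 0 ≤ C') (hC₂ : 0 ≤ C₂)
    (hD' : ∀ j : ℕ, j ≤ 3 → ∀ y : ℝ, 2 ≤ y → Dtau' (4 * j) y ≤ C' * Real.log y ^ 8192) :
    ∀ᶠ Y : ℝ in atTop, ∀ Q : ℕ, 1 ≤ Q → (Q : ℝ) ≤ Y ^ (δ / 4) →
      ∀ x : ℝ, Y / (2 * Real.log Y ^ 13) ≤ x → 2 * x ≤ Y → ∀ j ∈ Icc 1 3,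
        BI2 j x Y (Δf 8210 Y) (((2 * 20536 : ℕ) : ℝ)) C₂ Cτ (1 / 3 + δ / 2) 8192 (Kff 8210 Y) Q ≤ Y / Real.log Y ^ 16 := by
  have hlog : Tendsto (fun Y : ℝ => Real.log Y) atTop atTop := Real.tendsto_log_atTop
  obtain ⟨E, hE⟩ : ∃ E : ℝ, (2 : ℝ) ^ 8192 = E := ⟨_, rfl⟩
  have hE0 : 0 < E := by rw [← hE]; positivity
  obtain ⟨K₃, hK₃⟩ : ∃ K : ℝ, 768 * E * Cτ = K := ⟨_, rfl⟩
  obtain ⟨K₂, hK₂⟩ : ∃ K : ℝ, 36 * Real.sqrt ((4 * C' + 1) * C₂) + K₃ = K := ⟨_, rfl⟩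
  obtain ⟨K₄, hK₄⟩ : ∃ K : ℝ, 128 * E * Cτ = K := ⟨_, rfl⟩
  have hCτ0 : 0 ≤ Cτ := by linarith
  have hK₃0 : 0 ≤ K₃ := by rw [← hK₃]; positivity
  have hK₂0 : 0 ≤ K₂ := by rw [← hK₂]; positivity
  have hK₄0 : 0 ≤ K₄ := by rw [← hK₄]; positivity
  have hb'pos : 0 < 1 / 3 + δ / 4 := by linarith
  have hb'pos2 : 0 < 1 / 3 + δ / 8 := by linarith
  filter_upwards [hlog.eventually_ge_atTop (4 + Real.log 64 + 2 * K₂),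
    ((tendsto_pow_atTop (by norm_num : (8210 : ℕ) ≠ 0)).comp hlog).eventually_ge_atTop 2,
    (tendsto_rpow_atTop hb'pos).eventually_ge_atTop K₄,
    (tendsto_rpow_atTop hb'pos2).eventually_ge_atTop K₃,
    eventually_log_rpow_le_rpow' ((8209 : ℕ) : ℝ) (by positivity : (0 : ℝ) < δ / 8),
    tendsto_lowScale.eventually_ge_atTop 1, Filter.eventually_gt_atTop (1 : ℝ)] with Y hL hLA hgap1 hgap2 hgap3 hlo hY1
    Q hQ1 hQ x hx hxY j hj
  obtain ⟨hj1, hj3⟩ := Finset.mem_Icc.1 hj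
  set L := Real.log Y with hLdef
  have hY0 : 0 < Y := by linarith
  have hY1' : 1 ≤ Y := hY1.le
  have hl64 : 0 < Real.log 64 := Real.log_pos (by norm_num)
  have hL1 : 1 ≤ L := by linarith
  have hL0 : 0 < L := by linarith
  have hLA' : 2 ≤ L ^ 8210 := by simpa using hLA
  have hLp : ∀ n : ℕ, 0 < L ^ n := fun n => pow_pos hL0 n
  have hx1 : 1 ≤ x := le_trans hlo hx
  have hx0 : 0 < x := by linarith
  have h2x : 2 ≤ 2 * x := by linarith
  have hQY : (Q : ℝ) ≤ Y := hQ.trans (by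
    calc Y ^ (δ / 4) ≤ Y ^ (1 : ℝ) := Real.rpow_le_rpow_of_exponent_le hY1' (by linarith)
      _ = Y := Real.rpow_one Y)
  have hYδ1 : 1 ≤ Y ^ (δ / 4) := Real.one_le_rpow hY1' (by linarith)
  have hYpow : ∀ a b : ℝ, Y ^ a * Y ^ b = Y ^ (a + b) := fun a b => (Real.rpow_add hY0 a b).symm
  have hb' : 0 < 1 - (1 / 3 + δ / 2) := by linarith
  -- `Dτ'` at `2x`
  have hD'x : Dtau' (4 * j) (2 * x) ≤ C' * L ^ 8192 := by
    refine (hD' j hj3 (2 * x) h2x).trans (mul_le_mul_of_nonneg_left ?_ hC')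
    exact pow_le_pow_left₀ (Real.log_nonneg (by linarith)) (Real.log_le_log (by linarith) hxY) _
  -- the gap hypothesis
  have hℓ : ell2 j x ≤ 2 * L := ell2_le hj3 hx0 hxY (by linarith)
  have hℓ1 : 1 ≤ ell2 j x := one_le_ell2 j (by linarith)
  have hℓe : ell2 j x ^ 8192 ≤ E * L ^ 8192 := by
    calc ell2 j x ^ 8192 ≤ (2 * L) ^ 8192 := pow_le_pow_left₀ (by linarith) hℓ _
      _ = E * L ^ 8192 := by rw [mul_pow, hE]
  have h2j : (2 : ℝ) ^ (2 * j) ≤ 64 := by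
    calc (2 : ℝ) ^ (2 * j) ≤ 2 ^ 6 := pow_le_pow_right₀ (by norm_num) (by omega)
      _ = 64 := by norm_num
  have hrp : (2 * x) ^ (1 - (1 / 3 + δ / 2)) ≤ Y ^ (1 - (1 / 3 + δ / 2)) := Real.rpow_le_rpow (by linarith) hxY hb'.le
  have hgap : (Q : ℝ) * (2 * Cτ * ell2 j x ^ 8192 * 2 ^ (2 * j) * (2 * x) ^ (1 - (1 / 3 + δ / 2))) ≤ Y * L ^ 8194 := by
    calc (Q : ℝ) * (2 * Cτ * ell2 j x ^ 8192 * 2 ^ (2 * j) * (2 * x) ^ (1 - (1 / 3 + δ / 2)))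
        ≤ Y ^ (δ / 4) * (2 * Cτ * (E * L ^ 8192) * 64 * Y ^ (1 - (1 / 3 + δ / 2))) := by
          have : 0 ≤ ell2 j x ^ 8192 := by positivity
          have : 0 ≤ (2 * x) ^ (1 - (1 / 3 + δ / 2)) := Real.rpow_nonneg (by linarith) _
          gcongr
      _ = K₄ * (Y ^ (1 - (1 / 3 + δ / 2) + δ / 4) * L ^ 8192) := by rw [← hK₄, ← hYpow]; ring
      _ ≤ Y ^ (1 / 3 + δ / 4) * (Y ^ (1 - (1 / 3 + δ / 2) + δ / 4) * L ^ 8192) :=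
          mul_le_mul_of_nonneg_right hgap1 (by positivity)
      _ = Y * L ^ 8192 := by
          rw [← mul_assoc, hYpow, show (1 / 3 + δ / 4 + (1 - (1 / 3 + δ / 2) + δ / 4) : ℝ) = 1 by ring, Real.rpow_one]
      _ ≤ Y * L ^ 8194 := mul_le_mul_of_nonneg_left (pow_le_pow_right₀ hL1 (by norm_num)) hY0.le
  have hB := BI2_le (e := 8192) (A₁ := 8210) (A₂ := 20536) hj3 hx1 hxY (by linarith) hLA' hQ1 hQY hCτ0 hC₂ hC' hD'x
    hgap hb' (by norm_num) (by norm_num)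
  have e17a : (20536 : ℕ) - (2 * 8210 + 4099) = 17 := by norm_num
  have e17b : (8210 : ℕ) - (8192 + 1) = 17 := by norm_num
  have h2L : (2 * Real.log Y) ^ 8192 = E * Real.log Y ^ 8192 := by rw [mul_pow, hE]
  simp only [e17a] at hB
  rw [h2L, hE, hK₃] at hB
  refine hB.trans ?_
  -- first two terms: `K₂ Y / L^17 ≤ Y / (2 L^16)`
  have h12 : 36 * Real.sqrt ((4 * C' + 1) * C₂) * Y / L ^ 17 + K₃ * Y / L ^ 17 ≤ Y / L ^ 16 / 2 := by
    rw [← add_div, show 36 * Real.sqrt ((4 * C' + 1) * C₂) * Y + K₃ * Y = K₂ * Y by rw [← hK₂]; ring,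
      div_div, div_le_div_iff₀ (hLp 17) (by positivity)]
    calc K₂ * Y * (L ^ 16 * 2) = (2 * K₂) * Y * L ^ 16 := by ring
      _ ≤ L * Y * L ^ 16 := by gcongr; linarith
      _ = Y * L ^ 17 := by ring
  -- third term
  have h3 : Cτ * (E * L ^ 8192) * 64 * Y ^ (1 - (1 / 3 + δ / 2)) * (4 * L + 2 * Q) ≤ Y / L ^ 16 / 2 := by
    have hQ' : 4 * L + 2 * (Q : ℝ) ≤ 6 * L * Y ^ (δ / 4) := by
      have h1 : 4 * L ≤ 4 * L * Y ^ (δ / 4) := le_mul_of_one_le_right (by positivity) hYδ1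
      have h2 : 2 * Y ^ (δ / 4) ≤ 2 * L * Y ^ (δ / 4) :=
        mul_le_mul_of_nonneg_right (by linarith) (by positivity)
      linarith
    have hgap3' : L ^ 8209 ≤ Y ^ (δ / 8) := by
      have e : L ^ 8209 = L ^ (((8209 : ℕ) : ℝ)) := (Real.rpow_natCast _ _).symm
      rw [e]; exact hgap3
    rw [div_div, le_div_iff₀ (by positivity)]
    calc Cτ * (E * L ^ 8192) * 64 * Y ^ (1 - (1 / 3 + δ / 2)) * (4 * L + 2 * Q) * (L ^ 16 * 2)
        ≤ Cτ * (E * L ^ 8192) * 64 * Y ^ (1 - (1 / 3 + δ / 2)) * (6 * L * Y ^ (δ / 4)) * (L ^ 16 * 2) := by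
          have : 0 ≤ Cτ * (E * L ^ 8192) * 64 * Y ^ (1 - (1 / 3 + δ / 2)) := by positivity
          gcongr
      _ = K₃ * L ^ 8209 * (Y ^ (1 - (1 / 3 + δ / 2)) * Y ^ (δ / 4)) := by
          rw [← hK₃, show (8209 : ℕ) = 8192 + 1 + 16 from rfl, pow_add, pow_add, pow_one]; ring
      _ ≤ Y ^ (1 / 3 + δ / 8) * Y ^ (δ / 8) * (Y ^ (1 - (1 / 3 + δ / 2)) * Y ^ (δ / 4)) := by
          have : 0 ≤ Y ^ (1 - (1 / 3 + δ / 2)) * Y ^ (δ / 4) := by positivity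
          exact mul_le_mul_of_nonneg_right (mul_le_mul hgap2 hgap3' (by positivity) (by positivity)) this
      _ = Y := by
          rw [hYpow, hYpow, hYpow, show (1 / 3 + δ / 8 + δ / 8 + (1 - (1 / 3 + δ / 2) + δ / 4) : ℝ) = 1 by ring,
            Real.rpow_one]
  linarith [h12, h3]

/-- `SLIV ≤ Y/(log Y)^{10}` for large `Y`. [folklore] -/
theorem SLIV_small_eventually (hδ : 0 < δ) (hδ12 : δ ≤ 1 / 12) (h : ℕ) {C_φ C_S x₀S : ℝ} (hCφ : 0 ≤ C_φ) (hCS : 0 ≤ C_S)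
    (hφ : ∀ Y : ℝ, 2 ≤ Y → ∀ Q : ℕ, (Q : ℝ) ≤ Y → ∑ q ∈ Icc 1 Q, ((Nat.totient q : ℝ))⁻¹ ≤ C_φ * Real.log Y ^ 4)
    (hSh : ∀ j ∈ Icc 1 3, ∀ x y : ℝ, x₀S ≤ x → 1 ≤ x → 0 ≤ y → x ^ ((1 : ℝ) / 4) ≤ y → y ≤ x → ∀ q : ℕ, 1 ≤ q →
      (q : ℝ) < y ^ ((1 : ℝ) - 1 / 4) → ∀ a : ℕ, a.Coprime q →
        ∑ n ∈ (Icc 1 ⌊x + y⌋₊).filter (fun n : ℕ => x < n ∧ (n : ZMod q) = (a : ZMod q)), (σ 0 n : ℝ) ^ (2 * j) ≤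
          C_S * y / (Nat.totient q : ℝ) * Real.log x ^ (2 ^ (2 * j) - 1)) :
    ∀ᶠ Y : ℝ in atTop, ∀ Q : ℕ, 1 ≤ Q → (Q : ℝ) ≤ Y ^ (δ / 4) →
      ∀ x : ℝ, Y / (2 * Real.log Y ^ 13) ≤ x → 2 * x ≤ Y → ∀ j ∈ Icc 1 3,
        SLIV j h Q x (Δf 8210 Y) ≤ Y / Real.log Y ^ 10 := by
  have hlog : Tendsto (fun Y : ℝ => Real.log Y) atTop atTop := Real.tendsto_log_atTop
  obtain ⟨K₅, hK₅⟩ : ∃ K : ℝ, 3 / 2 * C_S * C_φ = K := ⟨_, rfl⟩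
  have hK₅0 : 0 ≤ K₅ := by rw [← hK₅]; positivity
  filter_upwards [hlog.eventually_ge_atTop (1 + K₅),
    ((tendsto_pow_atTop (by norm_num : (8210 : ℕ) ≠ 0)).comp hlog).eventually_ge_atTop 2,
    tendsto_lowScale.eventually_ge_atTop (max x₀S 1),
    eventually_log_rpow_le_rpow' ((8210 : ℕ) : ℝ) (by norm_num : (0 : ℝ) < 3 / 16),
    (tendsto_rpow_atTop (by norm_num : (0 : ℝ) < 3 / 16)).eventually_ge_atTop 2,
    eventually_log_rpow_le_rpow' ((8223 : ℕ) : ℝ) (by norm_num : (0 : ℝ) < 1 / 4),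
    (tendsto_rpow_atTop (by norm_num : (0 : ℝ) < 1 / 4)).eventually_ge_atTop 2,
    Filter.eventually_ge_atTop (4 : ℝ)] with Y hL hLA hlo hsh1 hsh2 hsh3 hsh4 hY4
    Q hQ1 hQ x hx hxY j hj
  obtain ⟨hj1, hj3⟩ := Finset.mem_Icc.1 hj
  set L := Real.log Y with hLdef
  have hY0 : 0 < Y := by linarith
  have hY1 : 1 < Y := by linarith
  have hY1' : 1 ≤ Y := hY1.le
  have hL1 : 1 ≤ L := by linarith
  have hL0 : 0 < L := by linarith
  have hK₅L : K₅ ≤ L := by linarith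
  have hLA' : 2 ≤ L ^ 8210 := by simpa using hLA
  have hLp : ∀ n : ℕ, 0 < L ^ n := fun n => pow_pos hL0 n
  have hx1 : 1 ≤ x := le_trans (le_trans (le_max_right _ _) hlo) hx
  have hx₀ : x₀S ≤ x := le_trans (le_trans (le_max_left _ _) hlo) hx
  have hx0 : 0 < x := by linarith
  have hQY : (Q : ℝ) ≤ Y := hQ.trans (by
    calc Y ^ (δ / 4) ≤ Y ^ (1 : ℝ) := Real.rpow_le_rpow_of_exponent_le hY1' (by linarith)
      _ = Y := Real.rpow_one Y)
  have hYpow : ∀ a b : ℝ, Y ^ a * Y ^ b = Y ^ (a + b) := fun a b => (Real.rpow_add hY0 a b).symm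
  obtain ⟨hΔ0, hΔhalf⟩ := Δf_bounds (A₁ := 8210) hLA'
  have hΔ1 : Δf 8210 Y ≤ 1 := by linarith
  have hΔdef : Δf 8210 Y = (L ^ 8210)⁻¹ := rfl
  -- Shiu applicability
  have hL8223 : L ^ 13 * L ^ 8210 ≤ Y ^ ((1 : ℝ) / 4) := by
    rw [← pow_add]
    have e : L ^ (13 + 8210) = L ^ (((8223 : ℕ) : ℝ)) := (Real.rpow_natCast _ _).symm
    exact e ▸ hsh3
  have hL13 : L ^ 13 ≤ Y ^ ((1 : ℝ) / 4) :=
    le_trans (le_mul_of_one_le_right (by positivity) (one_le_pow₀ hL1)) hL8223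
  have hYq : Y ^ ((1 : ℝ) / 4) * Y ^ ((1 : ℝ) / 4) = Y ^ ((1 : ℝ) / 2) := by rw [hYpow]; norm_num
  have hYh : Y ^ ((1 : ℝ) / 2) * Y ^ ((1 : ℝ) / 2) = Y := by rw [hYpow]; norm_num
  -- `Y^{1/2} ≤ x`
  have hxhalf : Y ^ ((1 : ℝ) / 2) ≤ x := by
    refine le_trans ?_ hx
    rw [le_div_iff₀ (by positivity)]
    calc Y ^ ((1 : ℝ) / 2) * (2 * L ^ 13) ≤ Y ^ ((1 : ℝ) / 2) * (Y ^ ((1 : ℝ) / 4) * Y ^ ((1 : ℝ) / 4)) :=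
          mul_le_mul_of_nonneg_left (mul_le_mul hsh4 hL13 (by positivity) (by positivity)) (by positivity)
      _ = Y := by rw [hYq, hYh]
  -- `Y^{1/2} ≤ Δ x`
  have hΔx : Y ^ ((1 : ℝ) / 2) ≤ Δf 8210 Y * x := by
    rw [hΔdef, ← div_eq_inv_mul, le_div_iff₀ (hLp _)]
    refine le_trans ?_ hx
    rw [le_div_iff₀ (by positivity)]
    calc Y ^ ((1 : ℝ) / 2) * L ^ 8210 * (2 * L ^ 13) = Y ^ ((1 : ℝ) / 2) * (2 * (L ^ 13 * L ^ 8210)) := by ring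
      _ ≤ Y ^ ((1 : ℝ) / 2) * (Y ^ ((1 : ℝ) / 4) * Y ^ ((1 : ℝ) / 4)) :=
          mul_le_mul_of_nonneg_left (mul_le_mul hsh4 hL8223 (by positivity) (by positivity)) (by positivity)
      _ = Y := by rw [hYq, hYh]
  -- `(2x)^{1/4} ≤ Δ x`
  have hx38 : 2 * L ^ 8210 ≤ x ^ ((3 : ℝ) / 4) := by
    have h1 : L ^ 8210 ≤ Y ^ ((3 : ℝ) / 16) := by
      have e : L ^ 8210 = L ^ (((8210 : ℕ) : ℝ)) := (Real.rpow_natCast _ _).symm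
      exact e ▸ hsh1
    calc 2 * L ^ 8210 ≤ Y ^ ((3 : ℝ) / 16) * Y ^ ((3 : ℝ) / 16) := mul_le_mul hsh2 h1 (by positivity) (by positivity)
      _ = (Y ^ ((1 : ℝ) / 2)) ^ ((3 : ℝ) / 4) := by rw [hYpow, ← Real.rpow_mul hY0.le]; norm_num
      _ ≤ x ^ ((3 : ℝ) / 4) := Real.rpow_le_rpow (by positivity) hxhalf (by norm_num)
  have hy2 : (2 * x) ^ ((1 : ℝ) / 4) ≤ Δf 8210 Y * x := by
    rw [hΔdef, ← div_eq_inv_mul, le_div_iff₀ (hLp _)]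
    have h214 : (2 : ℝ) ^ ((1 : ℝ) / 4) ≤ 2 := by
      calc (2 : ℝ) ^ ((1 : ℝ) / 4) ≤ (2 : ℝ) ^ (1 : ℝ) := Real.rpow_le_rpow_of_exponent_le (by norm_num) (by norm_num)
        _ = 2 := Real.rpow_one 2
    have hx14 : 0 ≤ x ^ ((1 : ℝ) / 4) := Real.rpow_nonneg hx0.le _
    calc (2 * x) ^ ((1 : ℝ) / 4) * L ^ 8210 = (2 : ℝ) ^ ((1 : ℝ) / 4) * x ^ ((1 : ℝ) / 4) * L ^ 8210 := by
          rw [Real.mul_rpow (by norm_num) hx0.le]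
      _ ≤ 2 * x ^ ((1 : ℝ) / 4) * L ^ 8210 := by gcongr
      _ = x ^ ((1 : ℝ) / 4) * (2 * L ^ 8210) := by ring
      _ ≤ x ^ ((1 : ℝ) / 4) * x ^ ((3 : ℝ) / 4) := mul_le_mul_of_nonneg_left hx38 hx14
      _ = x := by rw [← Real.rpow_add hx0]; norm_num
  have hy1 : x ^ ((1 : ℝ) / 4) ≤ Δf 8210 Y * x :=
    le_trans (Real.rpow_le_rpow hx0.le (by linarith) (by norm_num)) hy2
  have hQlt : (Q : ℝ) < (Δf 8210 Y * x) ^ ((1 : ℝ) - 1 / 4) := by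
    calc (Q : ℝ) ≤ Y ^ (δ / 4) := hQ
      _ < Y ^ ((3 : ℝ) / 8) := (Real.rpow_lt_rpow_left_iff hY1).2 (by linarith)
      _ = (Y ^ ((1 : ℝ) / 2)) ^ ((1 : ℝ) - 1 / 4) := by rw [← Real.rpow_mul hY0.le]; norm_num
      _ ≤ (Δf 8210 Y * x) ^ ((1 : ℝ) - 1 / 4) := Real.rpow_le_rpow (by positivity) hΔx (by norm_num)
  have hS := SLIV_le (h := h) (Q := Q) hj3 hCS (hSh j hj) (hφ Y (by linarith) Q hQY) hx₀ hx1 hxY hL1 hΔ0 hΔ1 hy1 hy2 hQlt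
  refine hS.trans ?_
  rw [hΔdef, le_div_iff₀ (hLp 10)]
  have hxY' : x ≤ Y / 2 := by linarith
  calc 3 * C_S * C_φ * (L ^ 8210)⁻¹ * x * L ^ 71 * L ^ 10
      ≤ 3 * C_S * C_φ * (L ^ 8210)⁻¹ * (Y / 2) * L ^ 71 * L ^ 10 := by
        have : 0 ≤ (L ^ 8210)⁻¹ := by positivity
        gcongr
    _ = K₅ * Y * (L ^ 81 / L ^ 8210) := by rw [← hK₅]; ring
    _ ≤ L * Y * (L ^ 81 / L ^ 8210) := by gcongr
    _ = Y * (L ^ 82 / L ^ 8210) := by ring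
    _ ≤ Y * 1 := by
        refine mul_le_mul_of_nonneg_left ?_ hY0.le
        rw [div_le_one (hLp _)]
        exact pow_le_pow_right₀ hL1 (by norm_num)
    _ = Y := mul_one Y

end Sizes

end Summit.Parity.GeneralizedHardyLittlewood.Theorems.SieveToMAvg
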